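import Literature.MathematicalPhysics.QuantumFieldTheory.Balaban1983to89.Node00.Record12BgRowCoClass
import Literature.MathematicalPhysics.QuantumFieldTheory.Balaban1983to89.Node00.LargeFieldBackgroundCoOfRecord

/-!
# NODE 00 — ROW P11, CLASS EDITION: FILE 10's generic suppliers INSTANTIATED AT def-R's PRIMED MINIMISER `UbgMSCoOfRecord … s 𝐖` (the record's minimiser over print's
# class (6) = (1.7) ∧ (1.9), node00-def-R FILE 22 `Node00.LargeFieldBackgroundCoOfRecord`) — ONE token each for def-T's v1.4 `bg` row and K0a's 13d′∕14

Cell `pub-ymgap`, seat `pub-ymgap-node00-def-P11` g2 (R218); director-ym №149 (3)+(5), №150 SEQUENCING (2)–(3).  This file only APPLIES: FILE 10 (`VariationalThm1RegSepCo6`,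
`plaqSmallOn_∕coDivSmallOn_of_thm1RegSepCo6`, `bgRowAtDatumU_of_thm1RegSepCo6C1`, `bgRowAtDatum_one`) at def-R's faces (`isMinimizer_setOf_UbgMSCoOfRecord … hsol` on the solvable set,
`UbgMSCoOfRecord_eq_one_of_not_mem` off it).  NO `h9`: (1.9) at the minimiser is the class property `coDivClassOn_UbgMSCoOfRecord` (def-R), not an obligation.

HONEST FRAMING.  Application only; nothing of Bałaban asserted or discharged; K0⁗ NOT closed; counts unmoved (28∕28 · 5∕28); finite `𝕋⁴`; not continuum ∕ OS ∕ mass gap ∕ Clay.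
No `def`, no `instance`, no `sorry`.
-/

noncomputable section

open MeasureTheory
open scoped Matrix.Norms.L2Operator

namespace Literature.MathematicalPhysics.QuantumFieldTheory.Balaban1983to89.Node00

open T4Continuum B14.Eq218Concrete B15DeterminingSets B12RegularSpaces111 B14RegularSpaces234 B14Radii T4AxialGaugeSmallField

section AtRecordCo

variable {F : T4Family} {N : ℕ} [NeZero N]

/-- **★ def-R′'s BACKGROUND `UbgMSCoOfRecord … s 𝐖` IS `B₃·cR·ε_n`-REGULAR AT EVERY SCALE ON THE SOLVABLE SET** (plaquette half of (8)), from the class-(6) fact, for a separated sequence,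
comparable thresholds and a datum with print's (7) (`h7`). [cite: Balaban1985Variational, Thm 1 (2),(6)–(8) pp.278–279; Balaban1988Convergent, (2.12) p.256] -/
theorem plaqSmallOn_UbgMSCoOfRecord_of_thm1RegSepCo6 {B₃ a₀ a₁ : ℝ} (h15 : VariationalThm1RegSepCo6 F N B₃ a₀ a₁) (ν : Stage7Numerics) (M : ℕ)
    (g : ℕ → ℝ) (K k : ℕ) (cR : ℝ) (s : SeqOfRecord F ν M g K k) (hsep : Sect2.SeqSeparated ν.M₁ s)
    (hnum : ∀ n, n ≤ k → 0 < cR * epsOfRecord ν g n ∧ cR * epsOfRecord ν g n ≤ a₁ ∧ B₃ * (cR * epsOfRecord ν g n) ≤ ν.εreg) (ha₀ : ν.εreg ≤ a₀)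
    (hcomp : ∀ n, n < k → cR * epsOfRecord ν g n ≤ 2 * (cR * epsOfRecord ν g (n + 1)))
    {W : MSField (F.P K) (SU N)} (h7 : Sect2.DataSmall7P (avOfRecord F N K) s.Ω k (fun n => cR * epsOfRecord ν g n) W)
    (hsol : W ∈ solvableDom (avOfRecord F N K) (regMSCoOfRecord F N ν K k s.Ω) (genSet s.Ω k)) :
    ∀ n, n ≤ k → PlaqSmallOn (omegaPlaqs s.Ω n) (B₃ * (cR * epsOfRecord ν g n) * (F.P K).eta n ^ 2) (UbgMSCoOfRecord F N ν M g K k s W) :=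
  plaqSmallOn_of_thm1RegSepCo6 h15 ν M g K k cR s hsep hnum ha₀ hcomp h7 (isMinimizer_setOf_UbgMSCoOfRecord ν M g K k s hsol)

/-- The co-divergence half of (8) at def-R′'s background on the solvable set. [cite: Balaban1985Variational, Thm 1 (8) p.279; Balaban1985RegularSpaces, (1.9) p.77] -/
theorem coDivSmallOn_UbgMSCoOfRecord_of_thm1RegSepCo6 {B₃ a₀ a₁ : ℝ} (h15 : VariationalThm1RegSepCo6 F N B₃ a₀ a₁) (ν : Stage7Numerics) (M : ℕ)
    (g : ℕ → ℝ) (K k : ℕ) (cR : ℝ) (s : SeqOfRecord F ν M g K k) (hsep : Sect2.SeqSeparated ν.M₁ s)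
    (hnum : ∀ n, n ≤ k → 0 < cR * epsOfRecord ν g n ∧ cR * epsOfRecord ν g n ≤ a₁ ∧ B₃ * (cR * epsOfRecord ν g n) ≤ ν.εreg) (ha₀ : ν.εreg ≤ a₀)
    (hcomp : ∀ n, n < k → cR * epsOfRecord ν g n ≤ 2 * (cR * epsOfRecord ν g (n + 1)))
    {W : MSField (F.P K) (SU N)} (h7 : Sect2.DataSmall7P (avOfRecord F N K) s.Ω k (fun n => cR * epsOfRecord ν g n) W)
    (hsol : W ∈ solvableDom (avOfRecord F N K) (regMSCoOfRecord F N ν K k s.Ω) (genSet s.Ω k)) :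
    ∀ n, n ≤ k → Sect2.CoDivSmallOn (Sect2.omegaBonds s.Ω n) (B₃ * (cR * epsOfRecord ν g n) * (F.P K).eta n ^ 3) (UbgMSCoOfRecord F N ν M g K k s W) :=
  coDivSmallOn_of_thm1RegSepCo6 h15 ν M g K k cR s hsep hnum ha₀ hcomp h7 (isMinimizer_setOf_UbgMSCoOfRecord ν M g K k s hsol)

/-- **★★★ ROW P11's BODY AT `(s, 𝐖)` FOR def-R′'s PRIMED MINIMISER `UbgMSCoOfRecord … s 𝐖`** — the v1.4 `bg` row's supplier: on the solvable set FILE 10's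
`bgRowAtDatumU_of_thm1RegSepCo6C1` at `isMinimizer_setOf_UbgMSCoOfRecord`, off it the junk `1` by `bgRowAtDatum_one`.  Hypotheses: the class-(6) fact, print's (7) on the datum (`h7`),
the displayed C¹ class clause for the primed minimiser on the solvable set ([15] Thm 1 (9)–(10), gauge-free reading), the numerics∕letters of FILE 8∕9's ★★★ theorems — and NO `h9`.
[cite: Balaban1985Variational, Thm 1 (2),(6)–(10) pp.278–279; Balaban1988Convergent, (2.12) p.256, (2.27)–(2.28) p.259, (2.34)–(2.41) p.261; Balaban1987RG1, (1.11)–(1.16) p.262] -/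
theorem bgRowAtDatumCo_of_thm1RegSepCo6C1 {B₃ B₃' a₀ a₁ tI tMS : ℝ} (h15 : VariationalThm1RegSepCo6 F N B₃ a₀ a₁)
    (S : Sect2.Setting (MatA N) (SU N)) (hι : S.ι = ιSU N) (h𝓜 : S.𝓜 = B12RegularSpaces111SpecialUnitary.suModel N) (hS : S.Laws) (hpos : S.Pos)
    (ν : Stage7Numerics) {M : ℕ} (hM : 0 < M) (K k : ℕ) (cR : ℝ) (hB₃ : 0 ≤ B₃) (hB₃' : 0 ≤ B₃')
    (hg : ∀ j, 1 ≤ j → j ≤ k → 0 < S.flow.g j ∧ S.flow.g j ^ 2 ≤ Real.exp (-1)) (hpq : ν.p₀ ≤ S.lf.q₀)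
    (hnum : ∀ n, n ≤ k → 0 < cR * epsOfRecord ν S.flow.g n ∧ cR * epsOfRecord ν S.flow.g n ≤ a₁ ∧ B₃ * (cR * epsOfRecord ν S.flow.g n) ≤ ν.εreg)
    (ha₀ : ν.εreg ≤ a₀) (hcomp : ∀ n, n < k → cR * epsOfRecord ν S.flow.g n ≤ 2 * (cR * epsOfRecord ν S.flow.g (n + 1)))
    (hα : ∀ n, 1 ≤ n → n ≤ k → 0 < S.lf.alpha0 (S.flow.g n) ∧ 0 < S.lf.alpha1 (S.flow.g n))
    (hBα : ∀ n, 1 ≤ n → n ≤ k → B₃ * (cR * epsOfRecord ν S.flow.g n) ≤ (1 - S.βc) * S.lf.alpha0 (S.flow.g n))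
    (hΛI0 : 0 ≤ (4 * (B₃ + (((F.P K).d - 1 : ℕ) : ℝ) * (((F.P K).L : ℝ) * M) * B₃') + 16 * ((((F.P K).d - 1 : ℕ) : ℝ) * (((F.P K).L : ℝ) * M)) ^ 2 * B₃ ^ 2 * a₁) * cR * ν.A₀)
    (hΛI : (4 * (B₃ + (((F.P K).d - 1 : ℕ) : ℝ) * (((F.P K).L : ℝ) * M) * B₃') + 16 * ((((F.P K).d - 1 : ℕ) : ℝ) * (((F.P K).L : ℝ) * M)) ^ 2 * B₃ ^ 2 * a₁) * cR * ν.A₀ ≤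
      tI * S.lf.C₀) (htI : tI < S.cB)
    (hΛMS0 : 0 ≤ (4 * (B₃ + (((F.P K).d - 1 : ℕ) : ℝ) * (M : ℝ) * B₃') + 16 * ((((F.P K).d - 1 : ℕ) : ℝ) * (M : ℝ)) ^ 2 * B₃ ^ 2 * a₁) * cR * ν.A₀)
    (hΛMS : (4 * (B₃ + (((F.P K).d - 1 : ℕ) : ℝ) * (M : ℝ) * B₃') + 16 * ((((F.P K).d - 1 : ℕ) : ℝ) * (M : ℝ)) ^ 2 * B₃ ^ 2 * a₁) * cR * ν.A₀ ≤ tMS * S.lf.C₀)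
    (htMS : tMS < S.B * S.C * S.Mr)
    (hsN : ∀ n, 1 ≤ n → n ≤ k + 1 → ((B14.Eq213MaximalDomains.side (F.P K).L M n : ℕ) : ℤ) < (F.P K).sitesPerDir 0)
    (hcB : 2 * (((F.P K).d - 1 : ℕ) : ℝ) * ((F.P K).L * M) < S.cB) (hBCM : 2 * (((F.P K).d - 1 : ℕ) : ℝ) * M < S.B * S.C * S.Mr)
    (hsmallI : ∀ j, 1 ≤ j → j ≤ k → (((F.P K).d - 1 : ℕ) : ℝ) * ((F.P K).L * M) * (F.P K).eta j * (B₃ * (cR * epsOfRecord ν S.flow.g j)) ≤ 1 / 2)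
    (hsmallMS : ∀ n, 1 ≤ n → n ≤ k → (((F.P K).d - 1 : ℕ) : ℝ) * M * (F.P K).eta n * (B₃ * (cR * epsOfRecord ν S.flow.g n)) ≤ 1 / 2)
    (hC1 : ∀ j, 1 ≤ j → j ≤ k → ∃ t : ℕ, 0 < t ∧ RkOfRecord (F.P K).L ν.r (S.flow.g j) = (F.P K).L * t)
    (hC2 : ∀ j, 1 ≤ j → j ≤ k → dCubeSide (F.P K).L M (RkOfRecord (F.P K).L ν.r (S.flow.g j)) j ∣ (F.P K).sitesPerDir 0)
    (s : SeqOfRecord F ν M S.flow.g K k) (hsep : Sect2.SeqSeparated ν.M₁ s) (W : MSField (F.P K) (SU N))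
    (h7 : Sect2.DataSmall7P (avOfRecord F N K) s.Ω k (fun n => cR * epsOfRecord ν S.flow.g n) W)
    (hclassC1 : W ∈ solvableDom (avOfRecord F N K) (regMSCoOfRecord F N ν K k s.Ω) (genSet s.Ω k) →
      ∀ n, 1 ≤ n → n ≤ k → PlaqC1SmallOn (plaqInside (s.Ω n)) (B₃' * (cR * epsOfRecord ν S.flow.g n) * (F.P K).eta n ^ 3) (UbgMSCoOfRecord F N ν M S.flow.g K k s W)) :
    ∀ j, 1 ≤ j → j ≤ k → ∀ X : (Sect2.domSys (F.P K) M j).Dom,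
      (Sect2.domSites (F.P K) M j X ⊆ s.Λ j →
        Sect2.ofBackgroundC S.ι (UbgMSCoOfRecord F N ν M S.flow.g K k s W) ∈
          Sect2.spaceI S (Sect2.Residual.unit (F.P K) (MatA N)) M j (Sect2.domSites (F.P K) M j X) (S.lf.alpha0 (S.flow.g j)) (S.lf.alpha1 (S.flow.g j))) ∧
      (Sect2.admB (F.P K) ν M S.flow.g s.Ω s.Λ j (Sect2.domSites (F.P K) M j X) = true →
        Sect2.ofBackgroundC S.ι (UbgMSCoOfRecord F N ν M S.flow.g K k s W) ∈
          Sect2.spaceMS S (Sect2.Residual.unit (F.P K) (MatA N)) M j (Sect2.domSites (F.P K) M j X) s.Ω) := by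
  by_cases hsol : W ∈ solvableDom (avOfRecord F N K) (regMSCoOfRecord F N ν K k s.Ω) (genSet s.Ω k)
  · exact bgRowAtDatumU_of_thm1RegSepCo6C1 h15 S hι h𝓜 hS hpos ν hM K k cR hB₃ hB₃' hg hpq hnum ha₀ hcomp hα hBα hΛI0 hΛI htI hΛMS0 hΛMS htMS
      hsN hcB hBCM hsmallI hsmallMS hC1 hC2 s hsep h7 (isMinimizer_setOf_UbgMSCoOfRecord ν M S.flow.g K k s hsol) (hclassC1 hsol)
  · rw [UbgMSCoOfRecord_eq_one_of_not_mem ν M S.flow.g K k s hsol]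
    exact bgRowAtDatum_one S hpos ν M K k s hα

end AtRecordCo

end Literature.MathematicalPhysics.QuantumFieldTheory.Balaban1983to89.Node00

end
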